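import Literature.MathematicalPhysics.QuantumFieldTheory.Balaban1983to89.B14Eq12InteriorLocality
import Summits.QuantumFields.YangMills.Theorems.BalabanUVNodesN21ThresholdMixtureRStepLocalityPlaq

/-!
# N21 (NE7c), strategy s3 «alternative currency», file 22c — (LOC) SETTLED BY THE TREE (LENS nearmiss g12 §L, landed verbatim with credit): what the (2.16)
# configuration `U_{k,□}(V)` reads (the datum on every `Γ₀`-corridor bond — the NEGATIVE EDGE for file 22's config-level `hloc`∕`hdep`), and the DISCHARGE of
# file 22b's plaquette-level hypothesis for the interior-local normalisation `normalise bg hreg`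

PROVENANCE AND CREDIT.  This module is the planner seat `ym-lens-BalabanUVNodes-nearmiss`'s `Sketch-nearmiss-g12.lean` §L (sha16 54f6b1ba96079ca3; memo
`LENS-nearmiss.md` v12.0; bus LOCATED-LOC l.18411) landed VERBATIM by seat `pub-ymgap-dag-n21-e` (g8) as the companion of its erratum-by-successor 22b
(`…RStepLocalityPlaq`); the filer's only changes: this header, the namespace, and the lens's (L3) lemma replaced by a citation of 22b's generic
`fibreIndep_supStat_of_localPlaq` (the (L4) proof routed through it).  Lane: `--kind proof --supports stmt-QuantumFields-20292 --as helper` (K3⁗).  Count-neutral.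

THE CONTENT (lens (L1)–(L4)).  (L1) By [Balaban1988Convergent] (2.2) the scale-0 member of `𝐁_k(□^{≈4})` is `Γ₀ = Ω₁(□^{≈4})ᶜ` (`B14.Eq213DetSet.Bj_zero`) and the
(2.12) constraint at scale 0 PINS the minimal configuration to the datum `Q_k^{s*}V` on every `Γ₀`-bond (`ukBox_apply_of_mem_extBonds`; for the normalised map even
off the solvable set, `ukBox_normalise_apply_of_mem_extBonds`), i.e. to `V ⟨B^k(b₋), μ(b)⟩` on every corridor bond (`ukBox_apply_of_corridor`): the whole
configuration READS `V` FAR FROM `□^{≈4}`.  (L1″) NEGATIVE EDGE: two data agreeing on any set `B` missing such a far bond and differing there give DIFFERENT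
configurations (`ukBox_ne_of_far_corridor`, ★ `not_configLevel_hdep`, `not_configLevel_hdep_normalise`) — file 22's `hloc`∕`hdep` AS TYPED are refutable exactly
in the OFF situation they serve.  (L2) THE REPAIR: the slot statistic reads `U_{k,□}(V)` only through `U(∂p)`, `p ⊂ □^∼`; for the interior-local normalisation
`B14.Eq12InteriorLocality.ukBox_normalise_congr_on` gives agreement off the far bonds from `V = W` on the LOCAL read set `liftIter k (inputs (near 𝐁_k(□^{≈4})))`,
hence ★ `plaqHol_ukBox_normalise_congr` (= 22b's `hdepP` with `B c :=` that read set).  (L4) ★★ `fibreIndep_supStat_ukBox_normalise`: the block-sup statistic over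
plaquettes avoiding the far `Γ₀`-bonds is fibre-independent of every fibre MISSING the local read set — (LOC) PROVED, (DISJ) displayed, no `hloc`.  For RAW
`bgOfRecord` (= `UminOfRecord`, a predicate-fed selector) plaquette-level locality is NOT available without uniqueness-mod-gauge ([15] Thm 1, not in tree) —
the lens's one-line question to def-χ∕def-R «is the record's χ read through `normalise (bgOfRecord …) …`?» decides which currency the record consumes.

HONEST FRAMING.  NE7c is NOT PRINTED and NOT PROVED.  [folklore] bookkeeping over landed carriers (r11 `B14Eq12InteriorLocality`, `B14Eq216Concrete`,
`B14.Eq213DetSet`); nothing of Bałaban's asserted; N21 NOT discharged; count-neutral; one finite 𝕋⁴ at fixed `ε`; NOT ℝ⁴ ∕ OS ∕ gap ∕ Clay.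

CITATION HEADER (lean-in-tree rule 2026-08-18).  BY NAME: r11 `B14.Eq12InteriorLocality.normalise` ∕ `normalise_U_ext` ∕ `ukBox_normalise_congr_on` ∕ `plaqHol_congr`;
`B14.Eq216Concrete.ukBox` ∕ `qsstarGIter0_of_not_interior`; `B14.Eq213DetSet.Bj_zero` ∕ `extBonds` ∕ `farBonds` ∕ `liftIter` ∕ `inputs` ∕ `near`;
`B15DeterminingSets.DetBackground`; 22b `fibreIndep_supStat_of_localPlaq`; 22 `fibreIndep_comp_of_local`.  Context only (SHAPE): [Balaban1988Convergent]
(1.2) p. 246, (2.2) p. 255, (2.12) p. 256, (2.16)–(2.17) p. 257.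

WHAT IS PROVED ([folklore]; lens §L).  `ukBox_apply_of_mem_extBonds` · `ukBox_normalise_apply_of_mem_extBonds` · `ukBox_apply_of_corridor` · `ukBox_ne_of_far_corridor` ·
★ `not_configLevel_hdep` · `not_configLevel_hdep_normalise` · ★ `plaqHol_ukBox_normalise_congr` · ★★ `fibreIndep_supStat_ukBox_normalise`.
-/

set_option autoImplicit false

noncomputable section

namespace Summit.QuantumFields.YangMills.Theorems.N21ThresholdMixtureRStepLocalityNormalise

open Literature.MathematicalPhysics.QuantumFieldTheory.Balaban1983to89
open B15DeterminingSets B14.Eq213DetSet B14.Eq216Concrete B14.Eq12InteriorLocality B14.Eq22Determines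
open Literature.MathematicalPhysics.QuantumFieldTheory.BalabanImbrieJaffe1984to88.BIJ85Eq453GaugeField
open Literature.MathematicalPhysics.QuantumFieldTheory.Balaban1983to89.T4DressedR (FibreIndep)
open Summit.QuantumFields.YangMills.Theorems.N21ThresholdMixtureRStepLocality (fibreIndep_comp_of_local)
open Summit.QuantumFields.YangMills.Theorems.N21ThresholdMixtureRStepLocalityPlaq (fibreIndep_supStat_of_localPlaq)

/-! ## §L  (LOC): what `U_{k,□}(V)` reads, as a whole configuration and on the tested plaquettes -/

section LOC

variable {P : Params} {G : Type*} [GaugeGroup G] {av : ∀ j, Averaging P j G}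
variable (bg : DetBackground P G av) (M₁ : ℕ)

/-- (L1) On the solvable set, the (2.12) constraint at scale `0` pins `U_{k,□}(V)` to the datum `Q_k^{s*}V` on every
`Γ₀`-bond of `𝐁_k(□^{≈4})` (`Γ₀ = Ω₁(□^{≈4})ᶜ`, `Bj_zero`). [cite: Balaban1988Convergent, (2.2) p.255, (2.12) p.256, (2.16) p.257] -/
theorem ukBox_apply_of_mem_extBonds {box4 : Set (Site P 0)} {k : ℕ} {V : GaugeField P k G}
    (hV : avgFamily av (qsstarGIter0 k V) ∈ bg.dom (Bj M₁ box4 k)) {b : PBond P 0} (hb : b ∈ extBonds (Bj M₁ box4 k)) :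
    ukBox bg M₁ box4 k V b = qsstarGIter0 k V b :=
  (bg.isMinimizer _ _ hV).2.1 0 b hb

/-- (L1, normalised edition) For the interior-local normalisation the same holds for EVERY datum (no solvability). [cite: Balaban1988Convergent, (2.2) p.255, (2.12) p.256] -/
theorem ukBox_normalise_apply_of_mem_extBonds (hreg : PlaqDetermined bg.reg) {box4 : Set (Site P 0)} {k : ℕ}
    (hk : k ≤ P.m + P.K) (V : GaugeField P k G) {b : PBond P 0} (hb : b ∈ extBonds (Bj M₁ box4 k)) :
    ukBox (normalise bg hreg) M₁ box4 k V b = qsstarGIter0 k V b :=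
  normalise_U_ext bg hreg (Bj_standingRange M₁ box4 hk) _ hb

/-- (L1′) … hence to the level-`k` variable `V ⟨B^k(b₋), μ(b)⟩` on every corridor `Γ₀`-bond ((1.3) with k-blocks).
[cite: Balaban1988Convergent, (1.3) p.246, (2.16) p.257] -/
theorem ukBox_apply_of_corridor {box4 : Set (Site P 0)} {k : ℕ} (hk : k ≤ P.m + P.K) {V : GaugeField P k G}
    (hV : avgFamily av (qsstarGIter0 k V) ∈ bg.dom (Bj M₁ box4 k)) {b : PBond P 0} (hb : b ∈ extBonds (Bj M₁ box4 k))
    (hcorr : blockIter k b.tgt ≠ blockIter k b.src) :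
    ukBox bg M₁ box4 k V b = V ⟨blockIter k b.src, b.dir⟩ := by
  rw [ukBox_apply_of_mem_extBonds bg M₁ hV hb, qsstarGIter0_of_not_interior hk V hcorr]

/-- (L1″) NEGATIVE EDGE.  Two solvable data that DIFFER at the level-`k` bond over a corridor `Γ₀`-bond give different
whole configurations `U_{k,□}` — whatever they do elsewhere. [cite: Balaban1988Convergent, (2.12) p.256, (2.16) p.257] -/
theorem ukBox_ne_of_far_corridor {box4 : Set (Site P 0)} {k : ℕ} (hk : k ≤ P.m + P.K) {V W : GaugeField P k G}
    (hV : avgFamily av (qsstarGIter0 k V) ∈ bg.dom (Bj M₁ box4 k)) (hW : avgFamily av (qsstarGIter0 k W) ∈ bg.dom (Bj M₁ box4 k))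
    {b : PBond P 0} (hb : b ∈ extBonds (Bj M₁ box4 k)) (hcorr : blockIter k b.tgt ≠ blockIter k b.src)
    (hne : V ⟨blockIter k b.src, b.dir⟩ ≠ W ⟨blockIter k b.src, b.dir⟩) :
    ukBox bg M₁ box4 k V ≠ ukBox bg M₁ box4 k W := by
  intro h
  apply hne
  rw [← ukBox_apply_of_corridor bg M₁ hk hV hb hcorr, ← ukBox_apply_of_corridor bg M₁ hk hW hb hcorr, h]

/-- (L1″, FILE 22's letters) The configuration-level (LOC) hypothesis `hdep` of
`N21ThresholdMixtureRStepLocality.fibreIndep_chi218_off_of_dependsOnBonds` for a read set `B` is CONTRADICTED by any two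
solvable data agreeing on `B` and differing at a corridor bond over `Γ₀` outside `B`. [cite: Balaban1988Convergent, (2.12) p.256, (2.16) p.257] -/
theorem not_configLevel_hdep {box4 : Set (Site P 0)} {k : ℕ} (hk : k ≤ P.m + P.K) (B : Set (PBond P k))
    {V W : GaugeField P k G} (hVW : ∀ c ∈ B, V c = W c)
    (hV : avgFamily av (qsstarGIter0 k V) ∈ bg.dom (Bj M₁ box4 k)) (hW : avgFamily av (qsstarGIter0 k W) ∈ bg.dom (Bj M₁ box4 k))
    {b : PBond P 0} (hb : b ∈ extBonds (Bj M₁ box4 k)) (hcorr : blockIter k b.tgt ≠ blockIter k b.src)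
    (hne : V ⟨blockIter k b.src, b.dir⟩ ≠ W ⟨blockIter k b.src, b.dir⟩) :
    ¬ (∀ V' W' : GaugeField P k G, (∀ c ∈ B, V' c = W' c) → ukBox bg M₁ box4 k V' = ukBox bg M₁ box4 k W') :=
  fun hdep => ukBox_ne_of_far_corridor bg M₁ hk hV hW hb hcorr hne (hdep V W hVW)

/-- (L1″, normalised edition) … and for the normalised map by ANY two data (no solvability). [cite: Balaban1988Convergent, (2.12) p.256] -/
theorem not_configLevel_hdep_normalise (hreg : PlaqDetermined bg.reg) {box4 : Set (Site P 0)} {k : ℕ} (hk : k ≤ P.m + P.K)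
    (B : Set (PBond P k)) {V W : GaugeField P k G} (hVW : ∀ c ∈ B, V c = W c)
    {b : PBond P 0} (hb : b ∈ extBonds (Bj M₁ box4 k)) (hcorr : blockIter k b.tgt ≠ blockIter k b.src)
    (hne : V ⟨blockIter k b.src, b.dir⟩ ≠ W ⟨blockIter k b.src, b.dir⟩) :
    ¬ (∀ V' W' : GaugeField P k G, (∀ c ∈ B, V' c = W' c) →
        ukBox (normalise bg hreg) M₁ box4 k V' = ukBox (normalise bg hreg) M₁ box4 k W') := by
  intro hdep
  apply hne
  have h := congrFun (hdep V W hVW) b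
  rwa [ukBox_normalise_apply_of_mem_extBonds bg M₁ hreg hk V hb, ukBox_normalise_apply_of_mem_extBonds bg M₁ hreg hk W hb,
    qsstarGIter0_of_not_interior hk V hcorr, qsstarGIter0_of_not_interior hk W hcorr] at h

/-- (L2) THE REPAIR AT PLAQUETTE LEVEL: for the interior-local normalisation, the plaquette variables `U_{k,□}(V)(∂p)`
on plaquettes avoiding the far `Γ₀`-bonds depend on `V` only through the LOCAL read set
`liftIter k (inputs (near 𝐁_k(□^{≈4})))`. [cite: Balaban1988Convergent, (1.2) p.246, (2.16)–(2.17) p.257] -/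
theorem plaqHol_ukBox_normalise_congr (hreg : PlaqDetermined bg.reg) {box4 : Set (Site P 0)} {k : ℕ} (hk : k ≤ P.m + P.K)
    {V W : GaugeField P k G} (h : ∀ c ∈ liftIter k (inputs (near (Bj M₁ box4 k))), V c = W c)
    {p : Plaq P 0} (hp : ∀ b ∈ plaqBonds p, b ∉ farBonds (Bj M₁ box4 k)) :
    GaugeField.plaqHol (ukBox (normalise bg hreg) M₁ box4 k V) p
      = GaugeField.plaqHol (ukBox (normalise bg hreg) M₁ box4 k W) p :=
  plaqHol_congr fun b hb => ukBox_normalise_congr_on bg hreg M₁ hk h b (hp b hb)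

variable {k : ℕ} [DecidableEq (PBond P k)]

/-! (L3) — the plaquette-level form of FILE 22's `fibreIndep_recordStat_of_local` — is file 22b's generic
`N21ThresholdMixtureRStepLocalityPlaq.fibreIndep_supStat_of_localPlaq` (cited, not restated). -/

/-- (L4) DISCHARGE AT THE NORMALISED MAP: the block-sup statistic of cube `□` over plaquettes avoiding the far `Γ₀`-bonds of
`𝐁_k(□^{≈4})` is fibre-independent of every fibre MISSING the local read set `liftIter k (inputs (near 𝐁_k(□^{≈4})))` —
OFF := disjointness from that set (FILE 22's (DISJ)), (LOC) := `B14.Eq12InteriorLocality` (PROVED), no `hloc`.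
[cite: Balaban1988Convergent, (2.16)–(2.17) p.257] -/
theorem fibreIndep_supStat_ukBox_normalise (hreg : PlaqDetermined bg.reg) {box4 : Set (Site P 0)} (hk : k ≤ P.m + P.K)
    (T : Set (Plaq P 0)) (hT : ∀ p ∈ T, ∀ b ∈ plaqBonds p, b ∉ farBonds (Bj M₁ box4 k)) (s : Finset (PBond P k))
    (hdisj : ∀ c ∈ liftIter k (inputs (near (Bj M₁ box4 k))), c ∉ s) :
    FibreIndep s fun V => ⨆ p : T, GaugeGroup.dist1 (GaugeField.plaqHol (ukBox (normalise bg hreg) M₁ box4 k V) p.1) :=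
  fibreIndep_supStat_of_localPlaq (fun V (p : T) => GaugeField.plaqHol (ukBox (normalise bg hreg) M₁ box4 k V) p.1)
    (fun u => ⨆ p : T, GaugeGroup.dist1 (u p)) s fun V y p =>
    plaqHol_ukBox_normalise_congr bg M₁ hreg hk
      (fun c hc => by simp only [Function.updateFinset, dif_neg (hdisj c hc)]) (hT p.1 p.2)

end LOC

end Summit.QuantumFields.YangMills.Theorems.N21ThresholdMixtureRStepLocalityNormalise

end
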